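import Mathlib
import HarnessLib
import Summits.Parity.GeneralizedHardyLittlewood.Theses.PrimeDeterminantCells

/-!
# Line `birth` — registered skeleton for the crux `AlternatingSeesawLawR` (stmt-Parity-11410)

Route `PrimeDeterminantCells` (route-Parity-PrimeDeterminantCells), crux rank 3, INDUCTIVE alternating seesaw
law: for `t ≥ 1`, `L`, IF `DimOne` holds for every `t' < t` THEN, uniformly over non-degenerate `d = 1` systems
`Ψ` of `t` forms with `‖Ψ‖_N ≤ L` and convex `K ⊆ [−N, N]`,
`C_t := Σ_{n ∈ K ∩ ℤ} Π_i W(ψ_i(n)) = (1/3)^t (log N)^t · (M + (−1)^t (S − M)) + o(N log^t N)`,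
`W(m) = Σ_{ab = m, m^{1/3} ≤ a ≤ m^{2/3}} Λ(a)Λ(b)`, `S = vonMangoldtSum Ψ K N`, `M = archFactor Ψ K · singularProduct Ψ`.

## The line: MIXED CELLS, ONE FLIP AT A TIME (strengthen-to-induct)

For a pattern `A ⊆ Fin t` let `C_A(Ψ, K)` be the MIXED cell: coordinate `i ∈ A` carries `W(ψ_i n)`, coordinate
`i ∉ A` carries `Λ(ψ_i n)` (so `C_∅ = S` and `C_univ = C_t`). The route's mechanism (Bombieri's asymptotic sieve on
one coordinate, `s ↦ 2 − s`) is an ATOMIC statement about one flip `A ↦ A ∪ {k}`: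

  `C_{A∪{k}} = (1/3) log N · (2·H_A − C_A) + o(N log^{|A|+1} N)`,  `H_A := (1/3)^{|A|} (log N)^{|A|} · M`   (Flip)

valid once every SHORTER system's mixed cells have their Hardy–Littlewood values (that is where the crux's
inductive hypothesis `DimOne(t' < t)` enters: the sifted sequence's mass and local densities are `(t−1)`-system
data). Along any chain `∅ ⊂ {k₁} ⊂ … ⊂ univ` the flips telescope (`c ↦ 2M − c`) to the MIXED ALTERNATING LAW

  `C_A = (1/3)^{|A|} (log N)^{|A|} · (M + (−1)^{|A|} (S − M)) + o(N log^{|A|} N)`                          (Law_A)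

whose `A = univ` instance is the crux. Three registered stubs, `sorry` ONLY inside them:

* `stub_baseWindowLaw`  — (Flip) at `t = 1` (only `A = ∅`, `k = 0`): `Σ_{n∈K} W(an+b) = (1/3) log N (2M − S) + o(N log N)`.
  PNT-grade (primes and balanced semiprimes in progression segments of modulus `≤ L`), theorem-sized.
* `stub_seesawStep`     — for `t ≥ 2`: `DimOne(<t) ∧ Law(<t) ⟹ (Flip) at t`. The conjecture-grade heart (one
  Bombieri/Friedlander–Iwaniec flip against mixed weights: level `N^{1−ε}` of the mixed sequences, EH/GEH-type).
* `stub_chainCollapse`  — for `t ≥ 1`: `(Flip) at t ⟹ (Law_A) at t, all A`. Elementary (induction on `|A|`,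
  `2M − (M + (−1)^j (S − M)) = M + (−1)^{j+1} (S − M)`, ε-bookkeeping); provable now.

Composition (sorry-free): `mixedLaw_of_hyps` — strong induction on `t` (the crux's hypothesis `DimOne(<t)` is
monotone in `t`, so the induction hypothesis supplies `Law(<t)`; `t = 1` uses the base stub, `t ≥ 2` the step) —
and `AlternatingSeesawLawR_of : stub_baseWindowLaw → stub_seesawStep → stub_chainCollapse → AlternatingSeesawLawR`
(hypotheses = the stub statements BY NAME, `Signature.stub_*`; conclusion = the route decl; the `A = univ` instance,
`Finset.mem_univ` + `card_univ` rewritten away); `AlternatingSeesawLawR_of_stubs : AlternatingSeesawLawR` feeds it the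
three sorried stubs (the only `sorry`s of the file).

Disproof used: none exists for this crux (`ledger crux ls stmt-Parity-11410`: no Disproof.lean, 2026-08-17).
Negatives honoured: ConvMomentLevelOne (stmt-Parity-9541: the FULL convolution `Λ⋆Λ` has a secondary main term)
— every statement here uses only the balanced window `[m^{1/3}, m^{2/3}]`; TupleElliott (stmt-Parity-14832:
a level hypothesis with a FIXED exemption level is false uniformly in shifts `≤ LN`) — no stub states a level
hypothesis; `stub_seesawStep` keeps it implicit and relative (its docstring names the shape a later split must use).
Refuter evidence honoured: `law_iff_cells : DimOne → (AlternatingSeesawLawR ↔ CentralCellsDimOne)` — the line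
does not route through `CentralCellsDimOne` (no circularity with crux 2); `hind_vacuous_at_one` — the `t = 1`
slice is its own PNT-grade stub.

BC3 audit (planner-skel-stmt-Parity-11410-0, 2026-08-17): `lean check --json` rc 0, errors none, sorries 3 = the three
`stub_*` (lines of `stub_baseWindowLaw`, `stub_seesawStep`, `stub_chainCollapse`), zero elsewhere; `mixedLaw_of_hyps`
and `AlternatingSeesawLawR_of` closed (axioms ⊆ propext/Classical.choice/Quot.sound). Probes (seat folder
`bc/probes.lean`, `bc/probes_split_{crux,sub}.lean`, `maxHeartbeats 400000` each): for every stub `Sᵢ`,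
`Sᵢ → AlternatingSeesawLawR` and `Sᵢ → GeneralizedHardyLittlewood` FAIL by `first | exact? | simpa | (unfold; simpa) |
aesop` (6/6) and by each tactic alone (24/24: `exact?` "could not close the goal" 6/6; for `stub_baseWindowLaw`
`simpa`/`unfold; simpa` end in `assumption` failed and `aesop` fails after exhaustive search; for the two other stubs
`simpa`/`aesop` exhaust the 400000 heartbeats in `whnf`). No stub is itself closed by `exact? | simp | aesop`
(`bc/triviality.lean`, 3/3 unsolved goals).
-/

namespace Summit.Parity.GeneralizedHardyLittlewood.Cruxes.AlternatingSeesawLawR.Birth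

open scoped BigOperators Classical
open Summit.Parity.GeneralizedHardyLittlewood.Theses.PrimeDeterminantCells (AlternatingSeesawLawR)

/-! ## Local abbreviations

Used ONLY inside the sorry-free composition below; the three stubs are stated fully inlined over existing
declarations (their texts are generated from the same templates, so each abbreviation unfolds to the inlined
text verbatim). -/

/-- `DimOne` at `(t, L)`: the Dickson–Hardy–Littlewood asymptotic for `d = 1` systems of `t` forms of size `≤ L`
(verbatim the body of `DicksonFibration.DimOne` / of the crux's inductive hypothesis). [folklore] -/
def DimOneAt (t L : ℕ) : Prop :=
  ∀ ε : ℝ, 0 < ε → ∃ N₀ : ℕ, ∀ N : ℕ, N₀ ≤ N → ∀ Ψ : Fin t →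
    Literature.NumberTheory.Sieve.AffLinForm 1, Literature.NumberTheory.Sieve.IsNondegenerateSystem
    Ψ → Literature.NumberTheory.Sieve.affLinSize Ψ N ≤ L → ∀ K : Set (Fin 1 → ℝ), Convex ℝ K → K ⊆
    Literature.NumberTheory.Sieve.realBox 1 N → |Literature.NumberTheory.Sieve.vonMangoldtSum Ψ K N
    - Literature.NumberTheory.Sieve.archFactor Ψ K * Literature.NumberTheory.Sieve.singularProduct
    Ψ| ≤ ε * (N : ℝ)

/-- The MIXED ALTERNATING LAW at `(t, L)`: for every pattern `A ⊆ Fin t` (coordinates carrying the balanced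
two-prime weight `W`; the others carry `Λ`) the mixed cell is
`(1/3)^|A| (log N)^|A| · (M + (−1)^|A| (S − M)) + o(N log^|A| N)`, uniformly. `A = univ` is the crux's law,
`A = ∅` is the tautology `S = S`. [folklore] -/
def MixedLawAt (t L : ℕ) : Prop :=
  ∀ ε : ℝ, 0 < ε → ∃ N₀ : ℕ, ∀ N : ℕ, N₀ ≤ N → ∀ Ψ : Fin t →
    Literature.NumberTheory.Sieve.AffLinForm 1, Literature.NumberTheory.Sieve.IsNondegenerateSystem
    Ψ → Literature.NumberTheory.Sieve.affLinSize Ψ N ≤ L → ∀ K : Set (Fin 1 → ℝ), Convex ℝ K → K ⊆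
    Literature.NumberTheory.Sieve.realBox 1 N → ∀ A : Finset (Fin t), |(∑ n ∈
    (Literature.NumberTheory.Sieve.latticeBox 1 N).filter (fun n =>
    Literature.NumberTheory.Sieve.realPoint n ∈ K), ∏ i, (if i ∈ A then ∑ ab ∈
    (Nat.divisorsAntidiagonal ((Ψ i).eval n).toNat).filter (fun ab : ℕ × ℕ => ((((Ψ i).eval
    n).toNat : ℕ) : ℝ) ^ (1 / 3 : ℝ) ≤ (ab.1 : ℝ) ∧ (ab.1 : ℝ) ≤ ((((Ψ i).eval n).toNat : ℕ) : ℝ) ^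
    (2 / 3 : ℝ)), ArithmeticFunction.vonMangoldt ab.1 * ArithmeticFunction.vonMangoldt ab.2 else
    ArithmeticFunction.vonMangoldt ((Ψ i).eval n).toNat)) - (1 / 3 : ℝ) ^ A.card * Real.log N ^
    A.card * (Literature.NumberTheory.Sieve.archFactor Ψ K *
    Literature.NumberTheory.Sieve.singularProduct Ψ + (-1 : ℝ) ^ A.card *
    (Literature.NumberTheory.Sieve.vonMangoldtSum Ψ K N - Literature.NumberTheory.Sieve.archFactor
    Ψ K * Literature.NumberTheory.Sieve.singularProduct Ψ))| ≤ ε * (N : ℝ) * Real.log N ^ A.card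

/-- ONE BOMBIERI FLIP at `(t, L)`: for every pattern `A` and every coordinate `k ∉ A`, flipping `Λ ↦ W` on `k`
turns the mixed cell `C_A` into `(1/3) log N · (2·(1/3)^|A| (log N)^|A| M − C_A) + o(N log^(|A|+1) N)`
(the seesaw `s ↦ 2 − s` with the Hardy–Littlewood main term inserted). [folklore] -/
def FlipAt (t L : ℕ) : Prop :=
  ∀ ε : ℝ, 0 < ε → ∃ N₀ : ℕ, ∀ N : ℕ, N₀ ≤ N → ∀ Ψ : Fin t →
    Literature.NumberTheory.Sieve.AffLinForm 1, Literature.NumberTheory.Sieve.IsNondegenerateSystem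
    Ψ → Literature.NumberTheory.Sieve.affLinSize Ψ N ≤ L → ∀ K : Set (Fin 1 → ℝ), Convex ℝ K → K ⊆
    Literature.NumberTheory.Sieve.realBox 1 N → ∀ A : Finset (Fin t), ∀ k : Fin t, k ∉ A → |(∑ n ∈
    (Literature.NumberTheory.Sieve.latticeBox 1 N).filter (fun n =>
    Literature.NumberTheory.Sieve.realPoint n ∈ K), ∏ i, (if i ∈ (insert k A) then ∑ ab ∈
    (Nat.divisorsAntidiagonal ((Ψ i).eval n).toNat).filter (fun ab : ℕ × ℕ => ((((Ψ i).eval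
    n).toNat : ℕ) : ℝ) ^ (1 / 3 : ℝ) ≤ (ab.1 : ℝ) ∧ (ab.1 : ℝ) ≤ ((((Ψ i).eval n).toNat : ℕ) : ℝ) ^
    (2 / 3 : ℝ)), ArithmeticFunction.vonMangoldt ab.1 * ArithmeticFunction.vonMangoldt ab.2 else
    ArithmeticFunction.vonMangoldt ((Ψ i).eval n).toNat)) - (1 / 3 : ℝ) * Real.log N * (2 * ((1 / 3
    : ℝ) ^ A.card * Real.log N ^ A.card * (Literature.NumberTheory.Sieve.archFactor Ψ K *
    Literature.NumberTheory.Sieve.singularProduct Ψ)) - (∑ n ∈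
    (Literature.NumberTheory.Sieve.latticeBox 1 N).filter (fun n =>
    Literature.NumberTheory.Sieve.realPoint n ∈ K), ∏ i, (if i ∈ A then ∑ ab ∈
    (Nat.divisorsAntidiagonal ((Ψ i).eval n).toNat).filter (fun ab : ℕ × ℕ => ((((Ψ i).eval
    n).toNat : ℕ) : ℝ) ^ (1 / 3 : ℝ) ≤ (ab.1 : ℝ) ∧ (ab.1 : ℝ) ≤ ((((Ψ i).eval n).toNat : ℕ) : ℝ) ^
    (2 / 3 : ℝ)), ArithmeticFunction.vonMangoldt ab.1 * ArithmeticFunction.vonMangoldt ab.2 else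
    ArithmeticFunction.vonMangoldt ((Ψ i).eval n).toNat)))| ≤ ε * (N : ℝ) * Real.log N ^ (A.card +
    1)

/-! ## The three registered stubs (the ONLY places where `sorry` occurs) -/

/-- **stub_baseWindowLaw — the one-form window law (t = 1; PNT-grade, theorem-sized L/XL).**
`FlipAt 1 L` for every `L`: with `Ψ = (ψ)`, `ψ(n) = a n + b`, `0 < |a| ≤ L`, `|b| ≤ L N`, the only instance is
`A = ∅`, `k = 0`, and it reads
`Σ_{n ∈ K ∩ ℤ} W(ψ(n)) = (1/3) log N · (2 M − S) + o(N log N)`, `W(m) = Σ_{ab = m, m^{1/3} ≤ a ≤ m^{2/3}} Λ(a)Λ(b)`,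
`S = Σ_{n ∈ K} Λ(ψ(n))`, `M = β_∞ · ∏_p β_p`, uniformly over such `ψ` and all intervals `K ⊆ [−N, N]`.
Balanced semiprimes in a segment of an arithmetic progression of modulus `≤ L`: PNT in progressions on
intervals of length `≫ εN` (for both `Λ` and `W = Σ Λ(a)Λ(b)` over the window, by partial summation in `a`)
plus a Brun–Titchmarsh / sieve upper bound `Σ_{n∈K} W(ψ n) ≪_L |K| log N` for `|K| ≤ εN`; `S ∼ M` by the same
PNT, so the seesaw is invisible here (the refuter's `hind_vacuous_at_one` / paper check
`Σ_{m≤x} W(m) = (1/3) x log x + O(x)`, crux evidence 2026-08-15). Why it might fail: only a normalisation slip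
(the factor `1/3`, `log N` vs `log m`, the sign of `a`) — decidable by the `t = 1` numerics of job j003251.
Sources: Davenport (Multiplicative Number Theory, §§19–22), MontgomeryVaughan2007 §11.3, BombieriRIMS1977.
Stated as the literal `t = 1` instance of `FlipAt` so that the composition is pure logic. -/
theorem stub_baseWindowLaw :
    ∀ L : ℕ, ∀ ε : ℝ, 0 < ε → ∃ N₀ : ℕ, ∀ N : ℕ, N₀ ≤ N → ∀ Ψ : Fin 1 →
      Literature.NumberTheory.Sieve.AffLinForm 1,
      Literature.NumberTheory.Sieve.IsNondegenerateSystem Ψ →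
      Literature.NumberTheory.Sieve.affLinSize Ψ N ≤ L → ∀ K : Set (Fin 1 → ℝ), Convex ℝ K → K ⊆
      Literature.NumberTheory.Sieve.realBox 1 N → ∀ A : Finset (Fin 1), ∀ k : Fin 1, k ∉ A → |(∑ n
      ∈ (Literature.NumberTheory.Sieve.latticeBox 1 N).filter (fun n =>
      Literature.NumberTheory.Sieve.realPoint n ∈ K), ∏ i, (if i ∈ (insert k A) then ∑ ab ∈
      (Nat.divisorsAntidiagonal ((Ψ i).eval n).toNat).filter (fun ab : ℕ × ℕ => ((((Ψ i).eval
      n).toNat : ℕ) : ℝ) ^ (1 / 3 : ℝ) ≤ (ab.1 : ℝ) ∧ (ab.1 : ℝ) ≤ ((((Ψ i).eval n).toNat : ℕ) : ℝ)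
      ^ (2 / 3 : ℝ)), ArithmeticFunction.vonMangoldt ab.1 * ArithmeticFunction.vonMangoldt ab.2
      else ArithmeticFunction.vonMangoldt ((Ψ i).eval n).toNat)) - (1 / 3 : ℝ) * Real.log N * (2 *
      ((1 / 3 : ℝ) ^ A.card * Real.log N ^ A.card * (Literature.NumberTheory.Sieve.archFactor Ψ K *
      Literature.NumberTheory.Sieve.singularProduct Ψ)) - (∑ n ∈
      (Literature.NumberTheory.Sieve.latticeBox 1 N).filter (fun n =>
      Literature.NumberTheory.Sieve.realPoint n ∈ K), ∏ i, (if i ∈ A then ∑ ab ∈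
      (Nat.divisorsAntidiagonal ((Ψ i).eval n).toNat).filter (fun ab : ℕ × ℕ => ((((Ψ i).eval
      n).toNat : ℕ) : ℝ) ^ (1 / 3 : ℝ) ≤ (ab.1 : ℝ) ∧ (ab.1 : ℝ) ≤ ((((Ψ i).eval n).toNat : ℕ) : ℝ)
      ^ (2 / 3 : ℝ)), ArithmeticFunction.vonMangoldt ab.1 * ArithmeticFunction.vonMangoldt ab.2
      else ArithmeticFunction.vonMangoldt ((Ψ i).eval n).toNat)))| ≤ ε * (N : ℝ) * Real.log N ^
      (A.card + 1) := by
  sorry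

/-- **stub_seesawStep — one Bombieri flip against mixed weights (t ≥ 2; the conjecture-grade heart, XL/open).**
For `t ≥ 2`: IF every shorter system has its Dickson–Hardy–Littlewood asymptotic (`DimOne` below `t`, the
crux's own inductive hypothesis) AND obeys the mixed alternating law (`MixedLawAt` below `t`, the induction
hypothesis of the line), THEN `FlipAt t L`: for every `t`-system `Ψ`, pattern `A ∌ k`,
`C_{A∪{k}}(Ψ,K) = (1/3) log N · (2·(1/3)^|A| (log N)^|A| M(Ψ,K) − C_A(Ψ,K)) + o(N log^(|A|+1) N)`.
Mechanism (BombieriRIMS1977 p.7; FriedlanderIwaniecPisa1978 Thm 1, vector form; tree: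
`Literature.NumberTheory.Sieve.Bombieri1976_asymptotic_sieve_holds`, `bombieri_asymptotic_sieve_indeterminacy`):
sift the sequence `a_m = Σ_{n ∈ K, ψ_k(n) = m} Π_{i∈A} W(ψ_i n) Π_{i∉A, i≠k} Λ(ψ_i n)`; its mass and local
densities are those of the `(t−1)`-system `Ψ^(k̂)` on `K ∩ {ψ_k > 0}` (twisted by progressions), whose mixed
cells have their Hardy–Littlewood values by the two antecedents, so `H·X = (1/3)^|A| (log N)^|A| M(Ψ,K)`
(`β_∞` unchanged, `Π_p β_p(Ψ) = Π_p β_p(Ψ^(k̂))·(1−g(p))/(1−1/p)`); Bombieri's localised identity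
(`Λ₂ = Λ·log + Λ⋆Λ`, Bernstein squeeze to the window `[m^{1/3}, m^{2/3}]`, Debouzy2019 §2) then gives
`Σ_m a_m W(m) = (1/3) log N (2HX − Σ_m a_m Λ(m)) + o`, and `Σ_m a_m Λ(m) = C_A(Ψ,K)`. Needs level of
distribution `N^{1−ε}` (every `ε`) of `a_m` in progressions — EH for `A = ∅`, GEH-type for the `W`-carrying
coordinates — with main terms RELATIVE to the twisted `(t−1)`-cells (not a fixed exemption level: cf. the
negatives index, `TupleElliott` stmt-Parity-14832, shift-divisor blindness). Why it might fail: that level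
hypothesis is open beyond the large sieve and Siegel-sensitive uniformly in shifts `≤ LN` — exactly the crux's
recorded risk, now isolated in this one stub; balanced window ⇒ no secondary terms of the ConvMomentLevelOne
kind (stmt-Parity-9541). Consistency: under "everything Hardy–Littlewood" both sides are
`(1/3)^(|A|+1) (log N)^(|A|+1) M`; at `t = 2`, `A = ∅` it is the prime/semiprime hyperbola
`Σ W(ψ_k n)Λ(ψ_j n) ≈ (1/3) log N (2M − S)` (= `CentralHyperbola`'s normalisation under HL).
Sources: BombieriRIMS1977, FriedlanderIwaniecPisa1978, Debouzy2019 (arXiv:1907.06393), Ford2004, Polymath8b2014. -/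
theorem stub_seesawStep :
    ∀ (t L : ℕ), 2 ≤ t → (∀ (t' L' : ℕ), 1 ≤ t' → t' < t → ∀ ε : ℝ, 0 < ε → ∃ N₀ : ℕ, ∀ N : ℕ, N₀ ≤
      N → ∀ Ψ : Fin t' → Literature.NumberTheory.Sieve.AffLinForm 1,
      Literature.NumberTheory.Sieve.IsNondegenerateSystem Ψ →
      Literature.NumberTheory.Sieve.affLinSize Ψ N ≤ L' → ∀ K : Set (Fin 1 → ℝ), Convex ℝ K → K ⊆
      Literature.NumberTheory.Sieve.realBox 1 N → |Literature.NumberTheory.Sieve.vonMangoldtSum Ψ K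
      N - Literature.NumberTheory.Sieve.archFactor Ψ K *
      Literature.NumberTheory.Sieve.singularProduct Ψ| ≤ ε * (N : ℝ)) → (∀ (t' L' : ℕ), 1 ≤ t' → t'
      < t → ∀ ε : ℝ, 0 < ε → ∃ N₀ : ℕ, ∀ N : ℕ, N₀ ≤ N → ∀ Ψ : Fin t' →
      Literature.NumberTheory.Sieve.AffLinForm 1,
      Literature.NumberTheory.Sieve.IsNondegenerateSystem Ψ →
      Literature.NumberTheory.Sieve.affLinSize Ψ N ≤ L' → ∀ K : Set (Fin 1 → ℝ), Convex ℝ K → K ⊆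
      Literature.NumberTheory.Sieve.realBox 1 N → ∀ A : Finset (Fin t'), |(∑ n ∈
      (Literature.NumberTheory.Sieve.latticeBox 1 N).filter (fun n =>
      Literature.NumberTheory.Sieve.realPoint n ∈ K), ∏ i, (if i ∈ A then ∑ ab ∈
      (Nat.divisorsAntidiagonal ((Ψ i).eval n).toNat).filter (fun ab : ℕ × ℕ => ((((Ψ i).eval
      n).toNat : ℕ) : ℝ) ^ (1 / 3 : ℝ) ≤ (ab.1 : ℝ) ∧ (ab.1 : ℝ) ≤ ((((Ψ i).eval n).toNat : ℕ) : ℝ)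
      ^ (2 / 3 : ℝ)), ArithmeticFunction.vonMangoldt ab.1 * ArithmeticFunction.vonMangoldt ab.2
      else ArithmeticFunction.vonMangoldt ((Ψ i).eval n).toNat)) - (1 / 3 : ℝ) ^ A.card * Real.log
      N ^ A.card * (Literature.NumberTheory.Sieve.archFactor Ψ K *
      Literature.NumberTheory.Sieve.singularProduct Ψ + (-1 : ℝ) ^ A.card *
      (Literature.NumberTheory.Sieve.vonMangoldtSum Ψ K N -
      Literature.NumberTheory.Sieve.archFactor Ψ K * Literature.NumberTheory.Sieve.singularProduct
      Ψ))| ≤ ε * (N : ℝ) * Real.log N ^ A.card) → ∀ ε : ℝ, 0 < ε → ∃ N₀ : ℕ, ∀ N : ℕ, N₀ ≤ N → ∀ Ψ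
      : Fin t → Literature.NumberTheory.Sieve.AffLinForm 1,
      Literature.NumberTheory.Sieve.IsNondegenerateSystem Ψ →
      Literature.NumberTheory.Sieve.affLinSize Ψ N ≤ L → ∀ K : Set (Fin 1 → ℝ), Convex ℝ K → K ⊆
      Literature.NumberTheory.Sieve.realBox 1 N → ∀ A : Finset (Fin t), ∀ k : Fin t, k ∉ A → |(∑ n
      ∈ (Literature.NumberTheory.Sieve.latticeBox 1 N).filter (fun n =>
      Literature.NumberTheory.Sieve.realPoint n ∈ K), ∏ i, (if i ∈ (insert k A) then ∑ ab ∈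
      (Nat.divisorsAntidiagonal ((Ψ i).eval n).toNat).filter (fun ab : ℕ × ℕ => ((((Ψ i).eval
      n).toNat : ℕ) : ℝ) ^ (1 / 3 : ℝ) ≤ (ab.1 : ℝ) ∧ (ab.1 : ℝ) ≤ ((((Ψ i).eval n).toNat : ℕ) : ℝ)
      ^ (2 / 3 : ℝ)), ArithmeticFunction.vonMangoldt ab.1 * ArithmeticFunction.vonMangoldt ab.2
      else ArithmeticFunction.vonMangoldt ((Ψ i).eval n).toNat)) - (1 / 3 : ℝ) * Real.log N * (2 *
      ((1 / 3 : ℝ) ^ A.card * Real.log N ^ A.card * (Literature.NumberTheory.Sieve.archFactor Ψ K *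
      Literature.NumberTheory.Sieve.singularProduct Ψ)) - (∑ n ∈
      (Literature.NumberTheory.Sieve.latticeBox 1 N).filter (fun n =>
      Literature.NumberTheory.Sieve.realPoint n ∈ K), ∏ i, (if i ∈ A then ∑ ab ∈
      (Nat.divisorsAntidiagonal ((Ψ i).eval n).toNat).filter (fun ab : ℕ × ℕ => ((((Ψ i).eval
      n).toNat : ℕ) : ℝ) ^ (1 / 3 : ℝ) ≤ (ab.1 : ℝ) ∧ (ab.1 : ℝ) ≤ ((((Ψ i).eval n).toNat : ℕ) : ℝ)
      ^ (2 / 3 : ℝ)), ArithmeticFunction.vonMangoldt ab.1 * ArithmeticFunction.vonMangoldt ab.2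
      else ArithmeticFunction.vonMangoldt ((Ψ i).eval n).toNat)))| ≤ ε * (N : ℝ) * Real.log N ^
      (A.card + 1) := by
  sorry

/-- **stub_chainCollapse — the flips collapse to the alternating law (elementary, provable now, M).**
For `t ≥ 1`: `FlipAt t L → MixedLawAt t L`. Proof sketch (induction on `j = |A|`, uniformly in `Ψ, K`):
`A = ∅`: the mixed cell IS `vonMangoldtSum Ψ K N` (`intVonMangoldt m = Λ m.toNat`, definitional) and the
main term is `M + (S − M) = S`, error `0`. Step: write `A = insert k A'`, `k ∉ A'`; the flip gives
`C_A = (1/3) log N (2 H_j M − C_{A'}) + O(ε₁ N log^(j+1) N)` with `H_j = (1/3)^j log^j N`, the induction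
hypothesis gives `C_{A'} = H_j (M + (−1)^j (S − M)) + O(ε₂ N log^j N)`, and
`2M − (M + (−1)^j (S − M)) = M + (−1)^(j+1) (S − M)`; take `ε₁ = ε/2`, `ε₂ = ε`, `N₀ = max`, `log N ≥ 0`.
This is the inclusion–exclusion collapse questioned in refuter review rreview-0815T14 P1, in the form the
mechanism supports (Hardy–Littlewood main terms inserted flip by flip). Why it might fail: it cannot
mathematically; only a Lean-statement slip (it is the certificate that the three bodies are mutually
consistent). Sources: BombieriRIMS1977 (the `s ↦ 2 − s` bookkeeping), GreenTao2010 (normalisations). -/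
theorem stub_chainCollapse :
    ∀ (t L : ℕ), 1 ≤ t → (∀ ε : ℝ, 0 < ε → ∃ N₀ : ℕ, ∀ N : ℕ, N₀ ≤ N → ∀ Ψ : Fin t →
      Literature.NumberTheory.Sieve.AffLinForm 1,
      Literature.NumberTheory.Sieve.IsNondegenerateSystem Ψ →
      Literature.NumberTheory.Sieve.affLinSize Ψ N ≤ L → ∀ K : Set (Fin 1 → ℝ), Convex ℝ K → K ⊆
      Literature.NumberTheory.Sieve.realBox 1 N → ∀ A : Finset (Fin t), ∀ k : Fin t, k ∉ A → |(∑ n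
      ∈ (Literature.NumberTheory.Sieve.latticeBox 1 N).filter (fun n =>
      Literature.NumberTheory.Sieve.realPoint n ∈ K), ∏ i, (if i ∈ (insert k A) then ∑ ab ∈
      (Nat.divisorsAntidiagonal ((Ψ i).eval n).toNat).filter (fun ab : ℕ × ℕ => ((((Ψ i).eval
      n).toNat : ℕ) : ℝ) ^ (1 / 3 : ℝ) ≤ (ab.1 : ℝ) ∧ (ab.1 : ℝ) ≤ ((((Ψ i).eval n).toNat : ℕ) : ℝ)
      ^ (2 / 3 : ℝ)), ArithmeticFunction.vonMangoldt ab.1 * ArithmeticFunction.vonMangoldt ab.2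
      else ArithmeticFunction.vonMangoldt ((Ψ i).eval n).toNat)) - (1 / 3 : ℝ) * Real.log N * (2 *
      ((1 / 3 : ℝ) ^ A.card * Real.log N ^ A.card * (Literature.NumberTheory.Sieve.archFactor Ψ K *
      Literature.NumberTheory.Sieve.singularProduct Ψ)) - (∑ n ∈
      (Literature.NumberTheory.Sieve.latticeBox 1 N).filter (fun n =>
      Literature.NumberTheory.Sieve.realPoint n ∈ K), ∏ i, (if i ∈ A then ∑ ab ∈
      (Nat.divisorsAntidiagonal ((Ψ i).eval n).toNat).filter (fun ab : ℕ × ℕ => ((((Ψ i).eval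
      n).toNat : ℕ) : ℝ) ^ (1 / 3 : ℝ) ≤ (ab.1 : ℝ) ∧ (ab.1 : ℝ) ≤ ((((Ψ i).eval n).toNat : ℕ) : ℝ)
      ^ (2 / 3 : ℝ)), ArithmeticFunction.vonMangoldt ab.1 * ArithmeticFunction.vonMangoldt ab.2
      else ArithmeticFunction.vonMangoldt ((Ψ i).eval n).toNat)))| ≤ ε * (N : ℝ) * Real.log N ^
      (A.card + 1)) → ∀ ε : ℝ, 0 < ε → ∃ N₀ : ℕ, ∀ N : ℕ, N₀ ≤ N → ∀ Ψ : Fin t →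
      Literature.NumberTheory.Sieve.AffLinForm 1,
      Literature.NumberTheory.Sieve.IsNondegenerateSystem Ψ →
      Literature.NumberTheory.Sieve.affLinSize Ψ N ≤ L → ∀ K : Set (Fin 1 → ℝ), Convex ℝ K → K ⊆
      Literature.NumberTheory.Sieve.realBox 1 N → ∀ A : Finset (Fin t), |(∑ n ∈
      (Literature.NumberTheory.Sieve.latticeBox 1 N).filter (fun n =>
      Literature.NumberTheory.Sieve.realPoint n ∈ K), ∏ i, (if i ∈ A then ∑ ab ∈
      (Nat.divisorsAntidiagonal ((Ψ i).eval n).toNat).filter (fun ab : ℕ × ℕ => ((((Ψ i).eval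
      n).toNat : ℕ) : ℝ) ^ (1 / 3 : ℝ) ≤ (ab.1 : ℝ) ∧ (ab.1 : ℝ) ≤ ((((Ψ i).eval n).toNat : ℕ) : ℝ)
      ^ (2 / 3 : ℝ)), ArithmeticFunction.vonMangoldt ab.1 * ArithmeticFunction.vonMangoldt ab.2
      else ArithmeticFunction.vonMangoldt ((Ψ i).eval n).toNat)) - (1 / 3 : ℝ) ^ A.card * Real.log
      N ^ A.card * (Literature.NumberTheory.Sieve.archFactor Ψ K *
      Literature.NumberTheory.Sieve.singularProduct Ψ + (-1 : ℝ) ^ A.card *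
      (Literature.NumberTheory.Sieve.vonMangoldtSum Ψ K N -
      Literature.NumberTheory.Sieve.archFactor Ψ K * Literature.NumberTheory.Sieve.singularProduct
      Ψ))| ≤ ε * (N : ℝ) * Real.log N ^ A.card := by
  sorry

/-! ## Named signatures

`Signature.stub_<name>` (last name component = the stub's name) is the statement of `stub_<name>` BY NAME, so that the
hypotheses of the sorry-free composition `AlternatingSeesawLawR_of` are the declared stubs by name for the
layer-invariant audit (`#h21_check_skeleton`). Each is written over the abbreviations above and δ-unfolds to the
inlined text of its stub verbatim (certified by `AlternatingSeesawLawR_of_stubs`, which feeds the `stub_*` theorems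
to `AlternatingSeesawLawR_of` at these types). -/

/-- Statement of `stub_baseWindowLaw`: `FlipAt 1 L` for every `L`. [folklore] -/
def Signature.stub_baseWindowLaw : Prop :=
  ∀ L : ℕ, FlipAt 1 L

/-- Statement of `stub_seesawStep`: for `t ≥ 2`, `DimOne(<t) → MixedLaw(<t) → FlipAt t L`. [folklore] -/
def Signature.stub_seesawStep : Prop :=
  ∀ (t L : ℕ), 2 ≤ t → (∀ (t' L' : ℕ), 1 ≤ t' → t' < t → DimOneAt t' L') →
    (∀ (t' L' : ℕ), 1 ≤ t' → t' < t → MixedLawAt t' L') → FlipAt t L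

/-- Statement of `stub_chainCollapse`: for `t ≥ 1`, `FlipAt t L → MixedLawAt t L`. [folklore] -/
def Signature.stub_chainCollapse : Prop :=
  ∀ (t L : ℕ), 1 ≤ t → FlipAt t L → MixedLawAt t L

/-! ## Composition (sorry-free): the three stub statements prove the crux BY NAME -/

/-- **The induction on the number of forms.** From the three stub statements: for every `t ≥ 1`, `DimOne`
below `t` implies the mixed alternating law at `t` (all `L`, all patterns `A`). Strong induction on `t`: the
antecedent `DimOne(<t)` restricts to `DimOne(<t')` for `t' < t`, so the induction hypothesis yields
`MixedLawAt t' L'`; then the base stub (`t = 1`) or the step stub (`t ≥ 2`) gives `FlipAt t L`, and the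
collapse stub turns it into `MixedLawAt t L`. [folklore] -/
theorem mixedLaw_of_hyps (hbase : Signature.stub_baseWindowLaw) (hstep : Signature.stub_seesawStep)
    (hrec : Signature.stub_chainCollapse) :
    ∀ t : ℕ, 1 ≤ t → (∀ t' L' : ℕ, 1 ≤ t' → t' < t → DimOneAt t' L') → ∀ L : ℕ, MixedLawAt t L := by
  dsimp only [Signature.stub_baseWindowLaw, Signature.stub_seesawStep, Signature.stub_chainCollapse]
    at hbase hstep hrec
  intro t
  induction t using Nat.strong_induction_on with
  | _ t ih =>
    intro ht hD L
    refine hrec t L ht ?_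
    rcases Nat.lt_or_ge t 2 with hlt | hge
    · obtain rfl : t = 1 := by omega
      exact hbase L
    · refine hstep t L hge hD ?_
      intro t' L' ht' hlt'
      exact ih t' hlt' ht' (fun t'' L'' h₁ h₂ => hD t'' L'' h₁ (lt_trans h₂ hlt')) L'

/-- **THE SKELETON THEOREM (BC3 composition).**
`stub_baseWindowLaw → stub_seesawStep → stub_chainCollapse → AlternatingSeesawLawR`: the hypotheses are the three
registered stub signatures BY NAME and the conclusion is literally the route decl
`PrimeDeterminantCells.AlternatingSeesawLawR` — the `A = Finset.univ` instance of the mixed alternating law from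
`mixedLaw_of_hyps` (`i ∈ univ` and `#univ = t` rewritten away, nothing else). A complete proof term: no `sorry`,
axioms `propext`/`Classical.choice`/`Quot.sound` only. [folklore] -/
theorem AlternatingSeesawLawR_of :
    Signature.stub_baseWindowLaw → Signature.stub_seesawStep → Signature.stub_chainCollapse →
      AlternatingSeesawLawR := by
  intro hbase hstep hrec t L ht hD ε hε
  have hML : MixedLawAt t L := mixedLaw_of_hyps hbase hstep hrec t ht hD L
  dsimp only [MixedLawAt] at hML
  obtain ⟨N₀, hN₀⟩ := hML ε hε
  refine ⟨N₀, fun N hN Ψ hΨ hL K hK hKN => ?_⟩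
  have h := hN₀ N hN Ψ hΨ hL K hK hKN Finset.univ
  simp only [Finset.mem_univ, if_true, Finset.card_univ, Fintype.card_fin] at h
  exact h

/-- **The skeleton instantiated:** the crux BY NAME modulo the three registered stubs (carries exactly their
three `sorry`s, nothing else) — also the certificate that each `Signature.stub_<name>` is definitionally the
statement of `stub_<name>`. [folklore] -/
theorem AlternatingSeesawLawR_of_stubs : AlternatingSeesawLawR :=
  AlternatingSeesawLawR_of stub_baseWindowLaw stub_seesawStep stub_chainCollapse

end Summit.Parity.GeneralizedHardyLittlewood.Cruxes.AlternatingSeesawLawR.Birth
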